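import Mathlib
import HarnessLib
import Summits.Ventures.LatticeQCDFlow.Scoring.RegenerativeTourCovariance
import Summits.Ventures.LatticeQCDFlow.Scoring.SplitChainCycleFormula
import Summits.Ventures.LatticeQCDFlow.Scoring.ReplicaChains

/-!
# THE REGENERATIVE (TOUR) ESTIMATOR OF A STATIONARY MEAN AND ITS CLT-FREE ERROR BAR: from ANY
# start, `R` complete tours of the split chain estimate `π(f)` by `Σ_i Y_i / Σ_i N_i` with
# `P(|Σ Y_i / Σ N_i − π(f)| ≥ s) ≤ (2 − ε)(2C)² / (ε² s² R)`

HONEST FRAMING: exact (Metropolis-corrected) sampling algorithms for lattice gauge theory;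
figures of merit are autocorrelation/cost numbers at stated couplings and volumes; no
continuum-physics claim.

Venture `LatticeQCDFlow` (cell pub-lqcd), topic `Scoring`; FANOUT row 8 (`s0-cpn-nemc`, GEN-16).
NEW WORK of the cell, not a published result; no definition is introduced.  Notation of
`Scoring/SplitChainTours.lean`: tour `i = {t : K_t = i}` of the coin-tagged path, tour length
`N_i = ∑' u, 1{K_u = i}`, tour sum `Y_i = ∑' u, 1{K_u = i} f(X_u)`, centred tour sum
`Z_i = ∑' u, 1{K_u = i} (f(X_u) − π(f))`.  The split chain of a Doeblin kernel `κ(x, ·) ≥ ε ν`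
(`0 < ε < 1`, `π` invariant) is run from ANY initial law; tour `0` (the segment before the first
regeneration) is discarded and the next `R` tours are used.  Assembly of the chapter:
`E_{ν̂}[Z_0] = 0` and `E[(Z_0)²] ≤ (2C)²(2 − ε)/ε²` (`Scoring/SplitChainCycleFormula.lean`), tours
`1, 2, …` distributed as tour `0` of the fresh chain (`Scoring/SplitChainTourTheorem.lean`), cross
moments factorising (`Scoring/RegenerativeTourCovariance.lean`) ⇒ the `Z_i`, `i ≥ 1`, are centred,
UNCORRELATED, with second moment `≤ (2C)²(2 − ε)/ε²`, so `E[(Σ_{i=1}^R Z_i)²] ≤ R (2C)²(2 − ε)/ε²`;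
pathwise `Σ Y_i − π(f) Σ N_i = Σ Z_i` and `N_i ≥ 1`; Chebyshev.  Printed counterpart NAMED ONLY: the
regenerative method for MCMC standard errors (Mykland–Tierney–Yu 1995, JASA 90, §3;
Hobert–Jones–Presnell–Rosenthal 2002, Biometrika 89, Thm 2 — there with a CLT; here a
finite-`R`, CLT-free Chebyshev certificate with explicit constants) — nothing is cited as a fact.

## Content (`e = ε.toReal`; `0 < ε < 1`; any initial law)

* `integral_sq_sum_le_of_uncorrelated` — bookkeeping: `E[(Σ_{i<R} W_i)²] ≤ R v` for pairwise
  orthogonal `W_i` with `E[W_i²] ≤ v`;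
* `tourLength_eq_finsetSum`, `one_le_tourLength` — pathwise: a finished tour's length is a finite
  sum and is `≥ 1`;
* **`splitChain_centredTourSum_uncorrelated`** — for `1 ≤ i, i'`, `i ≠ i'`: `E[Z_i Z_{i'}] = 0`;
  `E[Z_i²] ≤ (2C)² (2 − e)/e²`;
* **`regenerative_estimator_confidence`** — THE CERTIFICATE: for `|f| ≤ C` measurable, `R ≥ 1`
  tours and `s > 0`,
  `P(s ≤ |Σ_{i=1}^R Y_i / Σ_{i=1}^R N_i − π(f)|) ≤ (2 − e)(2C)² / (e² s² R)`.

Reading (value-free): an exact sampler whose kernel carries a Doeblin certificate `ε` (every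
independence sampler with a weight-ratio bound, the flow sampler of the cell) can report `π(f)` from
regeneration tours with an error bar that needs no autocorrelation time, no variance estimate and
no CLT — only `ε`, `C`, and the number of tours.  NOT CLAIMED: optimality of the constant (the
variance-sensitive `1/R` term of the CLT is not recovered; `ε²` in the denominator comes from
`N_i ≥ 1` in place of `Σ N_i ≈ R/ε`); any `ε` of a concrete sampler.
-/

noncomputable section

namespace Summit.Ventures.LatticeQCDFlow.Scoring

open MeasureTheory ProbabilityTheory Filter Finset Preorder Literature.Probability.MarkovChains
open scoped ENNReal

/-! ### Bookkeeping -/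

section Bookkeeping

/-- **Second moment of a sum of pairwise orthogonal terms**: if the products `W_i W_{i'}` are
integrable, `E[W_i W_{i'}] = 0` for `i ≠ i'` and `E[W_i²] ≤ v`, then `(Σ_{i<R} W_i)²` is integrable and
`E[(Σ_{i<R} W_i)²] ≤ R v`. -/
theorem integral_sq_sum_le_of_uncorrelated {α : Type*} [MeasurableSpace α] (μ : Measure α)
    (W : ℕ → α → ℝ) (R : ℕ) {v : ℝ}
    (hint : ∀ i ∈ Finset.range R, ∀ i' ∈ Finset.range R, Integrable (fun x => W i x * W i' x) μ)
    (horth : ∀ i ∈ Finset.range R, ∀ i' ∈ Finset.range R, i ≠ i' → ∫ x, W i x * W i' x ∂μ = 0)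
    (hvar : ∀ i ∈ Finset.range R, ∫ x, W i x * W i x ∂μ ≤ v) :
    Integrable (fun x => (∑ i ∈ Finset.range R, W i x) ^ 2) μ
      ∧ ∫ x, (∑ i ∈ Finset.range R, W i x) ^ 2 ∂μ ≤ R * v := by
  have hexp : ∀ x, (∑ i ∈ Finset.range R, W i x) ^ 2
      = ∑ i ∈ Finset.range R, ∑ i' ∈ Finset.range R, W i x * W i' x := fun x => by
    rw [sq, Finset.sum_mul_sum]
  have hI : Integrable (fun x => ∑ i ∈ Finset.range R, ∑ i' ∈ Finset.range R, W i x * W i' x) μ :=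
    integrable_finsetSum _ fun i hi => integrable_finsetSum _ fun i' hi' => hint i hi i' hi'
  refine ⟨hI.congr (ae_of_all _ fun x => (hexp x).symm), ?_⟩
  simp_rw [hexp]
  rw [integral_finsetSum _ fun i hi => integrable_finsetSum _ fun i' hi' => hint i hi i' hi']
  calc ∑ i ∈ Finset.range R, ∫ x, ∑ i' ∈ Finset.range R, W i x * W i' x ∂μ
      = ∑ i ∈ Finset.range R, ∫ x, W i x * W i x ∂μ := by
        refine Finset.sum_congr rfl fun i hi => ?_
        rw [integral_finsetSum _ fun i' hi' => hint i hi i' hi']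
        exact Finset.sum_eq_single_of_mem i hi fun i' hi' hne => horth i hi i' hi' (Ne.symm hne)
    _ ≤ ∑ _i ∈ Finset.range R, v := Finset.sum_le_sum fun i hi => hvar i hi
    _ = R * v := by rw [Finset.sum_const, Finset.card_range, nsmul_eq_mul]

variable {Ω : Type*}

/-- **A finished tour's length is a finite sum**: if `K_t = j`, `coin_{t+1}` heads and `i ≤ j`, then
`N_i = Σ_{u<t+1} 1{K_u = i}`. -/
theorem tourLength_eq_finsetSum (x : ℕ → Ω × Bool) {i j t : ℕ} (hij : i ≤ j)
    (ht : (∑ s ∈ Finset.range t, (if (x (s + 1)).2 then (1 : ℕ) else 0)) = j)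
    (hh : (x (t + 1)).2 = true) :
    ∑' u, (if (∑ s ∈ Finset.range u, (if (x (s + 1)).2 then (1 : ℕ) else 0)) = i
        then (1 : ℝ) else 0)
      = ∑ u ∈ Finset.range (t + 1), (if (∑ s ∈ Finset.range u,
        (if (x (s + 1)).2 then (1 : ℕ) else 0)) = i then (1 : ℝ) else 0) := by
  have h := tourSum_eq_finsetSum (fun _ _ => (1 : ℝ)) x hij ht hh
  simp only [mul_one] at h
  exact h

/-- **A started and finished tour has length `≥ 1`**: if tour `j + 1` starts (`K_{t₀} = j`,
`coin_{t₀+1}` heads) and tour `j + 2` starts (`K_{t₁} = j + 1`, `coin_{t₁+1}` heads), then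
`1 ≤ N_{j+1}`. -/
theorem one_le_tourLength (x : ℕ → Ω × Bool) {j t₀ t₁ : ℕ}
    (ht₀ : (∑ s ∈ Finset.range t₀, (if (x (s + 1)).2 then (1 : ℕ) else 0)) = j)
    (hh₀ : (x (t₀ + 1)).2 = true)
    (ht₁ : (∑ s ∈ Finset.range t₁, (if (x (s + 1)).2 then (1 : ℕ) else 0)) = j + 1)
    (hh₁ : (x (t₁ + 1)).2 = true) :
    1 ≤ ∑' u, (if (∑ s ∈ Finset.range u, (if (x (s + 1)).2 then (1 : ℕ) else 0)) = j + 1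
        then (1 : ℝ) else 0) := by
  rw [tourLength_eq_finsetSum x le_rfl ht₁ hh₁]
  have hK : (∑ s ∈ Finset.range (t₀ + 1), (if (x (s + 1)).2 then (1 : ℕ) else 0)) = j + 1 := by
    rw [headCount_succ, ht₀, hh₀]; rfl
  have hmem : t₀ + 1 ∈ Finset.range (t₁ + 1) := by
    rw [Finset.mem_range]
    by_contra h
    have := headCount_mono x (show t₁ ≤ t₀ by omega)
    omega
  calc (1 : ℝ) = (if (∑ s ∈ Finset.range (t₀ + 1), (if (x (s + 1)).2 then (1 : ℕ) else 0)) = j + 1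
        then (1 : ℝ) else 0) := by rw [if_pos hK]
    _ ≤ _ := Finset.single_le_sum (f := fun u => (if (∑ s ∈ Finset.range u,
        (if (x (s + 1)).2 then (1 : ℕ) else 0)) = j + 1 then (1 : ℝ) else 0))
        (fun u _ => by split_ifs <;> norm_num) hmem

end Bookkeeping

/-! ### The estimator -/

section Estimator

variable {Ω : Type*} [MeasurableSpace Ω]
  {κ : Kernel Ω Ω} [IsMarkovKernel κ] {ν : Measure Ω} [IsProbabilityMeasure ν] {ε : ℝ≥0∞}
  {hmin : ∀ x {B : Set Ω}, MeasurableSet B → ε * ν B ≤ κ x B}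
  (κs : Kernel (Ω × Bool) (Ω × Bool)) [IsMarkovKernel κs]
  (μs : Measure (Ω × Bool)) [IsProbabilityMeasure μs]

/-- **CENTRED TOUR SUMS OF DIFFERENT TOURS ARE UNCORRELATED, WITH BOUNDED SECOND MOMENT**: for
`π` invariant, `0 < ε < 1`, `|f| ≤ C` measurable, any initial law and `i, i'` (tours `i + 1 ≠ i' + 1`):
`Z_{i+1} Z_{i'+1}` is integrable, `E[Z_{i+1} Z_{i'+1}] = 0` for `i ≠ i'`, and
`E[Z_{i+1}²] ≤ (2C)² (2 − e)/e²`. -/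
theorem splitChain_centredTourSum_uncorrelated {π : Measure Ω} [IsProbabilityMeasure π]
    (hπ : Kernel.Invariant κ π) (hε0 : 0 < ε) (hε : ε < 1)
    (hκs : ∀ p, κs p = (ε • ν).map (fun y : Ω => (y, true))
      + ((1 - ε) • Doeblin.residualKernel κ ν ε hmin p.1).map (fun y : Ω => (y, false)))
    {f : Ω → ℝ} (hf : Measurable f) {C : ℝ} (hC : ∀ x, |f x| ≤ C) (i i' : ℕ) :
    Integrable (fun x : ℕ → Ω × Bool =>
        (∑' u, (if (∑ s ∈ Finset.range u, (if (x (s + 1)).2 then (1 : ℕ) else 0)) = i + 1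
          then (1 : ℝ) else 0) * (f (x u).1 - ∫ z, f z ∂π))
        * (∑' u, (if (∑ s ∈ Finset.range u, (if (x (s + 1)).2 then (1 : ℕ) else 0)) = i' + 1
          then (1 : ℝ) else 0) * (f (x u).1 - ∫ z, f z ∂π)))
      (Kernel.trajMeasure (X := fun _ : ℕ => Ω × Bool) μs
        (fun n : ℕ => κs.comap (fun h : (i : ↥(Finset.Iic n)) → Ω × Bool =>
          h ⟨n, Finset.mem_Iic.2 le_rfl⟩) (measurable_pi_apply _)))
    ∧ (i ≠ i' → ∫ x, (∑' u, (if (∑ s ∈ Finset.range u, (if (x (s + 1)).2 then (1 : ℕ) else 0))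
          = i + 1 then (1 : ℝ) else 0) * (f (x u).1 - ∫ z, f z ∂π))
        * (∑' u, (if (∑ s ∈ Finset.range u, (if (x (s + 1)).2 then (1 : ℕ) else 0)) = i' + 1
          then (1 : ℝ) else 0) * (f (x u).1 - ∫ z, f z ∂π))
        ∂(Kernel.trajMeasure (X := fun _ : ℕ => Ω × Bool) μs
          (fun n : ℕ => κs.comap (fun h : (i : ↥(Finset.Iic n)) → Ω × Bool =>
            h ⟨n, Finset.mem_Iic.2 le_rfl⟩) (measurable_pi_apply _))) = 0)
    ∧ (i = i' → ∫ x, (∑' u, (if (∑ s ∈ Finset.range u, (if (x (s + 1)).2 then (1 : ℕ) else 0))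
          = i + 1 then (1 : ℝ) else 0) * (f (x u).1 - ∫ z, f z ∂π))
        * (∑' u, (if (∑ s ∈ Finset.range u, (if (x (s + 1)).2 then (1 : ℕ) else 0)) = i' + 1
          then (1 : ℝ) else 0) * (f (x u).1 - ∫ z, f z ∂π))
        ∂(Kernel.trajMeasure (X := fun _ : ℕ => Ω × Bool) μs
          (fun n : ℕ => κs.comap (fun h : (i : ↥(Finset.Iic n)) → Ω × Bool =>
            h ⟨n, Finset.mem_Iic.2 le_rfl⟩) (measurable_pi_apply _)))
        ≤ (2 * C) ^ 2 * ((2 - ε.toReal) / ε.toReal ^ 2)) := by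
  haveI hνt : IsProbabilityMeasure (ν.map (fun y : Ω => (y, true))) :=
    Measure.isProbabilityMeasure_map (measurable_tagCoin true).aemeasurable
  set P := Kernel.trajMeasure (X := fun _ : ℕ => Ω × Bool) μs
      (fun n : ℕ => κs.comap (fun h : (i : ↥(Finset.Iic n)) → Ω × Bool =>
        h ⟨n, Finset.mem_Iic.2 le_rfl⟩) (measurable_pi_apply _)) with hP
  set c := ∫ z, f z ∂π with hc
  have hfi : |c| ≤ C := by
    calc |c| = ‖∫ z, f z ∂π‖ := (Real.norm_eq_abs _).symm
      _ ≤ C * π.real Set.univ := norm_integral_le_of_norm_le_const (Eventually.of_forall fun y => by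
          rw [Real.norm_eq_abs]; exact hC y)
      _ = C := by rw [probReal_univ, mul_one]
  have hg : Measurable fun y => f y - c := hf.sub_const _
  have hCg : ∀ y, |f y - c| ≤ 2 * C := fun y => by
    calc |f y - c| ≤ |f y| + |c| := abs_sub _ _
      _ ≤ C + C := add_le_add (hC y) hfi
      _ = 2 * C := by ring
  have hψ : Measurable fun pq : (Ω × Bool) × (Ω × Bool) => f pq.1.1 - c :=
    hg.comp (measurable_fst.comp measurable_fst)
  -- fresh-chain inputs: `E[Z_0] = 0`, `E[Z_0²] ≤ (2C)² (2-e)/e²`, `Z_0²` integrable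
  have hZ0 := (splitChain_fresh_integral_centredTourSum κs (κ := κ) (ν := ν) (hmin := hmin) hπ hε0
    hε hκs hf hC).2
  obtain ⟨hZ0sqI, hZ0sq⟩ := splitChain_fresh_sq_tourSum_le κs (ν.map (fun y : Ω => (y, true)))
    (κ := κ) (ν := ν) (hmin := hmin) hε0 hε hκs hg hCg
  -- the diagonal: tour `i + 1` is distributed as tour `0` of the fresh chain
  have hdiagI : ∀ k : ℕ, Integrable (fun x : ℕ → Ω × Bool =>
      (∑' u, (if (∑ s ∈ Finset.range u, (if (x (s + 1)).2 then (1 : ℕ) else 0)) = k + 1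
        then (1 : ℝ) else 0) * (f (x u).1 - c)) ^ 2) P := fun k =>
    splitChain_tourFunctional_integrable κs μs (κ := κ) (ν := ν) (hmin := hmin) hε hκs k
      (ψ₁ := fun p _ => f p.1 - c) (ψ₂ := fun p _ => f p.1 - c) hψ hψ (Λ := fun a _ => a ^ 2)
      (by norm_num) ((measurable_fst (α := ℝ) (β := ℝ)).pow_const 2) hZ0sqI
  have hdiagE : ∀ k : ℕ, ∫ x, (∑' u, (if (∑ s ∈ Finset.range u,
      (if (x (s + 1)).2 then (1 : ℕ) else 0)) = k + 1 then (1 : ℝ) else 0) * (f (x u).1 - c)) ^ 2 ∂P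
      = ∫ y, (∑' u, (if (∑ s ∈ Finset.range u, (if (y (s + 1)).2 then (1 : ℕ) else 0)) = 0
        then (1 : ℝ) else 0) * (f (y u).1 - c)) ^ 2
        ∂(Kernel.trajMeasure (X := fun _ : ℕ => Ω × Bool) (ν.map (fun y : Ω => (y, true)))
          (fun n : ℕ => κs.comap (fun h : (i : ↥(Finset.Iic n)) → Ω × Bool =>
            h ⟨n, Finset.mem_Iic.2 le_rfl⟩) (measurable_pi_apply _))) := fun k =>
    splitChain_tour_identically_distributed κs μs (κ := κ) (ν := ν) (hmin := hmin) hε0 hε hκs k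
      (ψ₁ := fun p _ => f p.1 - c) (ψ₂ := fun p _ => f p.1 - c) hψ hψ (Λ := fun a _ => a ^ 2)
      (by norm_num) ((measurable_fst (α := ℝ) (β := ℝ)).pow_const 2) hZ0sqI
  -- off-diagonal: cross moments factorise through `E[Z_0] = 0`
  have hcross : ∀ k k' : ℕ, k < k' → Integrable (fun x : ℕ → Ω × Bool =>
      (∑' u, (if (∑ s ∈ Finset.range u, (if (x (s + 1)).2 then (1 : ℕ) else 0)) = k + 1
        then (1 : ℝ) else 0) * (f (x u).1 - c))
      * (∑' u, (if (∑ s ∈ Finset.range u, (if (x (s + 1)).2 then (1 : ℕ) else 0)) = k' + 1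
        then (1 : ℝ) else 0) * (f (x u).1 - c))) P
      ∧ ∫ x, (∑' u, (if (∑ s ∈ Finset.range u, (if (x (s + 1)).2 then (1 : ℕ) else 0)) = k + 1
        then (1 : ℝ) else 0) * (f (x u).1 - c))
      * (∑' u, (if (∑ s ∈ Finset.range u, (if (x (s + 1)).2 then (1 : ℕ) else 0)) = k' + 1
        then (1 : ℝ) else 0) * (f (x u).1 - c)) ∂P = 0 := by
    intro k k' hkk'
    obtain ⟨hI, hE⟩ := splitChain_tour_crossMoment κs μs (κ := κ) (ν := ν) (hmin := hmin) hε0 hε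
      hκs hg hg hCg hCg (i := k + 1) (j := k') (by omega)
    refine ⟨hI, ?_⟩
    rw [hE, hZ0, mul_zero]
  rcases lt_trichotomy i i' with h | h | h
  · obtain ⟨hI, hE⟩ := hcross i i' h
    exact ⟨hI, fun _ => hE, fun heq => absurd heq (by omega)⟩
  · subst h
    refine ⟨(hdiagI i).congr (ae_of_all _ fun x => by simp only [sq]), fun hne => absurd rfl hne,
      fun _ => ?_⟩
    have h2 : ∫ x, (∑' u, (if (∑ s ∈ Finset.range u, (if (x (s + 1)).2 then (1 : ℕ) else 0))
          = i + 1 then (1 : ℝ) else 0) * (f (x u).1 - c))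
        * (∑' u, (if (∑ s ∈ Finset.range u, (if (x (s + 1)).2 then (1 : ℕ) else 0)) = i + 1
          then (1 : ℝ) else 0) * (f (x u).1 - c)) ∂P
        = ∫ x, (∑' u, (if (∑ s ∈ Finset.range u, (if (x (s + 1)).2 then (1 : ℕ) else 0)) = i + 1
          then (1 : ℝ) else 0) * (f (x u).1 - c)) ^ 2 ∂P :=
      integral_congr_ae (ae_of_all _ fun x => by simp only [sq])
    rw [h2, hdiagE i]
    exact hZ0sq
  · obtain ⟨hI, hE⟩ := hcross i' i h
    refine ⟨hI.congr (ae_of_all _ fun x => mul_comm _ _), fun _ => ?_,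
      fun heq => absurd heq (by omega)⟩
    exact (integral_congr_ae (ae_of_all _ fun x => mul_comm _ _)).trans hE

/-- **THE REGENERATIVE ESTIMATOR'S CLT-FREE ERROR BAR.**  `π` invariant, `κ(x, ·) ≥ ε ν` with
`0 < ε < 1`, `|f| ≤ C` measurable, any initial law of the split chain, `R ≥ 1`, `s > 0`.  With the
tours `1, …, R` (tour `0`, the segment before the first regeneration, discarded), the ratio
estimator `Σ_{i=1}^R Y_i / Σ_{i=1}^R N_i` of `π(f)` satisfies
`P(s ≤ |Σ Y_i / Σ N_i − π(f)|) ≤ (2 − e)(2C)² / (e² s² R)`. -/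
theorem regenerative_estimator_confidence {π : Measure Ω} [IsProbabilityMeasure π]
    (hπ : Kernel.Invariant κ π) (hε0 : 0 < ε) (hε : ε < 1)
    (hκs : ∀ p, κs p = (ε • ν).map (fun y : Ω => (y, true))
      + ((1 - ε) • Doeblin.residualKernel κ ν ε hmin p.1).map (fun y : Ω => (y, false)))
    {f : Ω → ℝ} (hf : Measurable f) {C : ℝ} (hC : ∀ x, |f x| ≤ C) {R : ℕ} (hR : 0 < R)
    {s : ℝ} (hs : 0 < s) :
    (Kernel.trajMeasure (X := fun _ : ℕ => Ω × Bool) μs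
        (fun n : ℕ => κs.comap (fun h : (i : ↥(Finset.Iic n)) → Ω × Bool =>
          h ⟨n, Finset.mem_Iic.2 le_rfl⟩) (measurable_pi_apply _))).real
      {x | s ≤ |(∑ i ∈ Finset.range R, ∑' u, (if (∑ s ∈ Finset.range u,
            (if (x (s + 1)).2 then (1 : ℕ) else 0)) = i + 1 then (1 : ℝ) else 0) * f (x u).1)
          / (∑ i ∈ Finset.range R, ∑' u, (if (∑ s ∈ Finset.range u,
            (if (x (s + 1)).2 then (1 : ℕ) else 0)) = i + 1 then (1 : ℝ) else 0))
          - ∫ z, f z ∂π|}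
      ≤ (2 - ε.toReal) * (2 * C) ^ 2 / (ε.toReal ^ 2 * s ^ 2 * R) := by
  set P := Kernel.trajMeasure (X := fun _ : ℕ => Ω × Bool) μs
      (fun n : ℕ => κs.comap (fun h : (i : ↥(Finset.Iic n)) → Ω × Bool =>
        h ⟨n, Finset.mem_Iic.2 le_rfl⟩) (measurable_pi_apply _)) with hP
  set c := ∫ z, f z ∂π with hc
  have he0 : 0 < ε.toReal := ENNReal.toReal_pos hε0.ne' (ne_top_of_lt hε)
  have hR0 : (0 : ℝ) < R := Nat.cast_pos.2 hR
  -- the centred tour sums `Z_{i+1}` are pairwise orthogonal with bounded second moment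
  have hU := fun i i' => splitChain_centredTourSum_uncorrelated κs μs (κ := κ) (ν := ν) (hmin := hmin)
    hπ hε0 hε hκs hf hC i i'
  obtain ⟨hSqI, hSq⟩ := integral_sq_sum_le_of_uncorrelated P
    (fun i x => ∑' u, (if (∑ s ∈ Finset.range u, (if (x (s + 1)).2 then (1 : ℕ) else 0)) = i + 1
      then (1 : ℝ) else 0) * (f (x u).1 - c)) R (v := (2 * C) ^ 2 * ((2 - ε.toReal) / ε.toReal ^ 2))
    (fun i _ i' _ => (hU i i').1) (fun i _ i' _ hne => (hU i i').2.1 hne)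
    (fun i _ => (hU i i).2.2 rfl)
  -- Chebyshev for `Σ Z_{i+1}` at level `s R`
  have hψ : Measurable fun pq : (Ω × Bool) × (Ω × Bool) => f pq.1.1 - c :=
    (hf.sub_const c).comp (measurable_fst.comp measurable_fst)
  have hZm : ∀ i, Measurable fun x : ℕ → Ω × Bool => ∑' u, (if (∑ s ∈ Finset.range u,
      (if (x (s + 1)).2 then (1 : ℕ) else 0)) = i + 1 then (1 : ℝ) else 0) * (f (x u).1 - c) :=
    fun i => measurable_tourSum (Ω := Ω) (ψ := fun p _ => f p.1 - c) hψ (i + 1)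
  have hmem : MemLp (fun x : ℕ → Ω × Bool => ∑ i ∈ Finset.range R, ∑' u, (if (∑ s ∈ Finset.range u,
      (if (x (s + 1)).2 then (1 : ℕ) else 0)) = i + 1 then (1 : ℝ) else 0) * (f (x u).1 - c)) 2 P :=
    (memLp_two_iff_integrable_sq (Finset.aestronglyMeasurable_fun_sum _ fun i _ =>
      (hZm i).aestronglyMeasurable)).2 hSqI
  have hCheb : P.real {x : ℕ → Ω × Bool | s * R ≤ |∑ i ∈ Finset.range R, ∑' u,
      (if (∑ s ∈ Finset.range u, (if (x (s + 1)).2 then (1 : ℕ) else 0)) = i + 1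
        then (1 : ℝ) else 0) * (f (x u).1 - c)|}
      ≤ (∫ x, (∑ i ∈ Finset.range R, ∑' u, (if (∑ s ∈ Finset.range u,
          (if (x (s + 1)).2 then (1 : ℕ) else 0)) = i + 1 then (1 : ℝ) else 0) * (f (x u).1 - c)) ^ 2 ∂P)
          / (s * R) ^ 2 := by
    simpa only [sub_zero] using measureReal_abs_sub_ge_le hmem 0 (mul_pos hs hR0)
  -- almost surely the estimator error is `|Σ Z| / Σ N` with `Σ N ≥ R`
  have hae := splitChain_ae_tourStart κs μs (κ := κ) (ν := ν) (hmin := hmin) hε0 hε hκs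
  rw [← hP] at hae
  have hincl : ∀ᵐ x ∂P, x ∈ {x : ℕ → Ω × Bool | s ≤ |(∑ i ∈ Finset.range R, ∑' u,
        (if (∑ s ∈ Finset.range u, (if (x (s + 1)).2 then (1 : ℕ) else 0)) = i + 1
          then (1 : ℝ) else 0) * f (x u).1)
        / (∑ i ∈ Finset.range R, ∑' u, (if (∑ s ∈ Finset.range u,
          (if (x (s + 1)).2 then (1 : ℕ) else 0)) = i + 1 then (1 : ℝ) else 0)) - c|}
      → x ∈ {x : ℕ → Ω × Bool | s * R ≤ |∑ i ∈ Finset.range R, ∑' u, (if (∑ s ∈ Finset.range u,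
        (if (x (s + 1)).2 then (1 : ℕ) else 0)) = i + 1 then (1 : ℝ) else 0) * (f (x u).1 - c)|} := by
    filter_upwards [hae] with x hx hbad
    -- finite-sum forms of `Y`, `N`, `Z` for the tours `i + 1`, `i < R`
    have hfin : ∀ i : ℕ, (∑' u, (if (∑ s ∈ Finset.range u, (if (x (s + 1)).2 then (1 : ℕ) else 0))
          = i + 1 then (1 : ℝ) else 0) * (f (x u).1 - c))
        = (∑' u, (if (∑ s ∈ Finset.range u, (if (x (s + 1)).2 then (1 : ℕ) else 0)) = i + 1
            then (1 : ℝ) else 0) * f (x u).1)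
          - c * (∑' u, (if (∑ s ∈ Finset.range u, (if (x (s + 1)).2 then (1 : ℕ) else 0))
            = i + 1 then (1 : ℝ) else 0)) := by
      intro i
      obtain ⟨t₁, ht₁, hh₁⟩ := hx (i + 1)
      have e1 := tourSum_eq_finsetSum (fun p _ => f p.1 - c) x le_rfl ht₁ hh₁
      have e2 := tourSum_eq_finsetSum (fun p _ => f p.1) x le_rfl ht₁ hh₁
      have e3 := tourLength_eq_finsetSum x le_rfl ht₁ hh₁
      rw [e1, e2, e3, Finset.mul_sum, ← Finset.sum_sub_distrib]
      exact Finset.sum_congr rfl fun u _ => by ring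
    have hN1 : ∀ i : ℕ, (1 : ℝ) ≤ ∑' u, (if (∑ s ∈ Finset.range u,
        (if (x (s + 1)).2 then (1 : ℕ) else 0)) = i + 1 then (1 : ℝ) else 0) := by
      intro i
      obtain ⟨t₀, ht₀, hh₀⟩ := hx i
      obtain ⟨t₁, ht₁, hh₁⟩ := hx (i + 1)
      exact one_le_tourLength x ht₀ hh₀ ht₁ hh₁
    set SY := ∑ i ∈ Finset.range R, ∑' u, (if (∑ s ∈ Finset.range u,
      (if (x (s + 1)).2 then (1 : ℕ) else 0)) = i + 1 then (1 : ℝ) else 0) * f (x u).1 with hSY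
    set SN := ∑ i ∈ Finset.range R, ∑' u, (if (∑ s ∈ Finset.range u,
      (if (x (s + 1)).2 then (1 : ℕ) else 0)) = i + 1 then (1 : ℝ) else 0) with hSN
    have hSNR : (R : ℝ) ≤ SN := by
      calc (R : ℝ) = ∑ _i ∈ Finset.range R, (1 : ℝ) := by simp
        _ ≤ SN := Finset.sum_le_sum fun i _ => hN1 i
    have hSN0 : 0 < SN := lt_of_lt_of_le hR0 hSNR
    have hSZ : ∑ i ∈ Finset.range R, ∑' u, (if (∑ s ∈ Finset.range u,
        (if (x (s + 1)).2 then (1 : ℕ) else 0)) = i + 1 then (1 : ℝ) else 0) * (f (x u).1 - c)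
        = (SY / SN - c) * SN := by
      rw [Finset.sum_congr rfl fun i _ => hfin i, Finset.sum_sub_distrib, ← Finset.mul_sum, sub_mul,
        div_mul_cancel₀ _ hSN0.ne']
    rw [hSZ, abs_mul, abs_of_pos hSN0]
    exact mul_le_mul hbad hSNR hR0.le (abs_nonneg _)
  -- assemble
  calc P.real _ ≤ P.real {x : ℕ → Ω × Bool | s * R ≤ |∑ i ∈ Finset.range R, ∑' u,
          (if (∑ s ∈ Finset.range u, (if (x (s + 1)).2 then (1 : ℕ) else 0)) = i + 1
            then (1 : ℝ) else 0) * (f (x u).1 - c)|} :=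
        ENNReal.toReal_mono (measure_ne_top _ _) (measure_mono_ae hincl)
    _ ≤ (∫ x, (∑ i ∈ Finset.range R, ∑' u, (if (∑ s ∈ Finset.range u,
          (if (x (s + 1)).2 then (1 : ℕ) else 0)) = i + 1 then (1 : ℝ) else 0) * (f (x u).1 - c)) ^ 2 ∂P)
          / (s * R) ^ 2 := hCheb
    _ ≤ (R * ((2 * C) ^ 2 * ((2 - ε.toReal) / ε.toReal ^ 2))) / (s * R) ^ 2 :=
        div_le_div_of_nonneg_right hSq (by positivity)
    _ = (2 - ε.toReal) * (2 * C) ^ 2 / (ε.toReal ^ 2 * s ^ 2 * R) := by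
        field_simp

end Estimator

end Summit.Ventures.LatticeQCDFlow.Scoring

end
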